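import Summits.HubbardSuperconductivity.HubbardLadder.Bounds.KinSymbolIntegrals
import HarnessLib

/-!
# Hubbard ladder — Bounds: the bandwidth-normalised extremiser of the one-body kinetic ceiling (t–t′ class)

HONEST FRAMING (cell pub-hubbard): ladder R1–R4 with certified numbers; no claim on H/H₀. These
are bounds for MODEL CLASSES (finite-range lattice fermions with gauge-invariant interactions);
no materials claim. Companion text with proofs and constants: `pub-hubbard/paper/bounds.tex`
(Proposition "bandwidth extremiser"), tables `pub-hubbard/pub-hubbard-bounds/EXTREMISERS.md` §3.

## Content

For the square-lattice `t`–`t′` class (units `t = 1`, `s = t′/t`) let `W` be the translation-invariant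
one-body matrix with `−T₁ − T₂ = Σ_σ dΓ_σ(W)`, where `T_a` is the hopping on the bonds `δ` with `δ_a ≠ 0`
(`bounds.tex` Def. "kinetic weights of a state": a diagonal bond belongs to BOTH directions, so
`T₁ + T₂ = T_nn + 2 T_nnn`). Its symbol is (`bounds.tex` Cor. "ceilings for 𝒦", with `t = 1`)

  `w_s(k) = 2 (cos k₁ + cos k₂) + 8 s cos k₁ cos k₂`        (`kinSymbol s k₁ k₂`).

The one-body ceiling (`bounds.tex` Thm. "one-body ceiling" = Lieb–Loss bathtub, and Cor. "ceilings for
𝒦" (iii)) gives for every rotation-invariant state `ρ` of ANY filling at ANY temperature — in particular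
for the Gibbs states and the ground-state projector of every rotation-invariant `H` of the class, whatever
the interaction — `𝒦₁(ρ) = 𝒦₂(ρ) ≤ |Λ|⁻¹ Σ_k w_s(k)⁺`, whose thermodynamic limit and supremum over
fillings is `s_max(s) = (2π)⁻² ∫_{BZ} w_s⁺ = ½ · (2π)⁻² ∫_{BZ} |w_s|` (`∫ w_s = 0`), i.e. `½ · kinL1 s` with

  `kinL1 s = (2π)⁻² ∫_{-π}^{π} ∫_{-π}^{π} |w_s(x, y)| dx dy`   (iterated interval integrals).

The oscillation (bandwidth) of `w_s` over the Brillouin zone is `kinBandwidth s = max 8 (4 + 16|s|)`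
(`kinSymbol_sub_le_kinBandwidth`, attained: `kinBandwidth_attained`). The dimensionless merit
`merit s = 4 · kinL1 s / kinBandwidth s = 8 s_max / W` measures the ceiling per unit bandwidth of the
kinetic symbol. Results (all sorry-free):

* (companion file `Bounds/KinSymbolIntegrals.lean`: the definitions `kinSymbol`, `kinL1`, `kinBandwidth`,
  `merit`, the API `bzInt`, and the exact constants `∫∫ |cos x + cos y| = 32`, `∫∫ |cos x cos y| = 16`);
* `kinL1_neg` (evenness in `s`, by the shift `k ↦ k + (π, π)`), `kinL1_mono` (non-decreasing in `|s|`: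
  convexity + evenness), `kinL1_le_add` (Lipschitz: `kinL1 s ≤ kinL1 s₀ + (32/π²)|s − s₀|`),
  `kinL1_zero` (`= 16/π²`);
* **`merit_le`: `merit s ≤ merit (1/4)` for every real `s`** — among all `t′/t`, the bandwidth-normalised
  one-body ceiling is largest at `|t′| = t/4`, the ratio at which the minimum of `w_s` leaves the zone
  corner `(π, π)` for the edge centres — a higher-order saddle of `w_s` at `(π, 0)`; the BAND `ε` has its
  own at `|t′| = t/2` — (for `|s| ≤ 1/4` the merit is `kinL1 s / 2`, non-decreasing; for `|s| ≥ 1/4` the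
  Lipschitz slope `32/π² = 2 · kinL1 0 ≤ 2 · kinL1 (1/4)` is exactly cancelled by the growth of the
  bandwidth — the argument is tight at the identity `‖cos x + cos y‖₁ = 2‖cos x cos y‖₁`).

* CAVEAT, also typed: the normalisation above is by the bandwidth of the KINETIC SYMBOL `w_s` (the operator
  that is being bounded). Normalised instead by the bandwidth `dispBandwidth s = max 8 (4 + 8|s|)` of the
  DISPERSION `ε_s = −(2(cos k₁ + cos k₂) + 4 s cos k₁ cos k₂)`, the merit `meritDisp` is non-decreasing on
  `[0, 1/2]` (`meritDisp_mono`) and `≤ 16/π² = 2 · merit 0` everywhere (`meritDisp_le`), a supremum that is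
  approached only as `|t′|/t → ∞` (companion text): under that normalisation there is NO interior
  extremiser — oblique (diagonal) bonds carry `x`-kinetic weight in both directions at no cost in
  bandwidth. Which normalisation is appropriate is a modelling choice; both are tabulated in
  `EXTREMISERS.md` §3. No statement about `T_c` is made or implied.

References: Hazra–Verma–Randeria, Phys. Rev. X 9, 031049 (2019), eqs. (2)–(3) and App. A (the
kinetic-energy bound this normalises); E. H. Lieb, M. Loss, *Analysis* (2001), Thm 1.14 (bathtub).
-/

namespace Summit.HubbardSuperconductivity.HubbardLadder.Bounds

open Real Set MeasureTheory intervalIntegral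

noncomputable section

/-! ## Bandwidth, `L¹` mass and the extremiser -/

/-- The bandwidth is positive. -/
theorem kinBandwidth_pos (s : ℝ) : 0 < kinBandwidth s :=
  lt_max_of_lt_left (by norm_num)

/-- The bandwidth is even in `s`. -/
theorem kinBandwidth_neg (s : ℝ) : kinBandwidth (-s) = kinBandwidth s := by
  simp [kinBandwidth, abs_neg]

/-! ### Bandwidth: `max 8 (4 + 16|s|)` is the oscillation of `w_s` -/

/-- Upper envelope: `w_s ≤ 4 + 8s` for `s ≥ 0` (value at `k = 0`). -/
theorem kinSymbol_le {s : ℝ} (hs : 0 ≤ s) (x y : ℝ) : kinSymbol s x y ≤ 4 + 8 * s := by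
  unfold kinSymbol
  have ha1 := cos_le_one x
  have ha2 := neg_one_le_cos x
  have hb1 := cos_le_one y
  have hb2 := neg_one_le_cos y
  have hab : cos x * cos y ≤ 1 := by
    have := abs_cos_le_one x
    have := abs_cos_le_one y
    calc cos x * cos y ≤ |cos x * cos y| := le_abs_self _
      _ = |cos x| * |cos y| := abs_mul _ _
      _ ≤ 1 * 1 := by gcongr
      _ = 1 := by ring
  nlinarith [mul_nonneg hs (sub_nonneg.2 hab)]

/-- Lower envelope: `min (8s − 4) (−8s) ≤ w_s` (values at `(π, π)` and `(0, π)`), every real `s`. -/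
theorem le_kinSymbol (s x y : ℝ) :
    min (8 * s - 4) (-(8 * s)) ≤ kinSymbol s x y := by
  unfold kinSymbol
  have ha1 := cos_le_one x
  have ha2 := neg_one_le_cos x
  have hb1 := cos_le_one y
  have hb2 := neg_one_le_cos y
  rcases le_or_gt s (1 / 4) with h | h
  · -- `w - (8s - 4) = 2(1 + a) + 2(1 + b) - 8 s (1 - ab) ≥ 2 (1 + a)(1 + b) ≥ 0`
    have hmin : min (8 * s - 4) (-(8 * s)) = 8 * s - 4 := min_eq_left (by linarith)
    rw [hmin]
    have hab : cos x * cos y ≤ 1 := by nlinarith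
    nlinarith [mul_nonneg (by linarith : (0:ℝ) ≤ 1 + cos x) (by linarith : (0:ℝ) ≤ 1 + cos y),
      mul_nonneg (by linarith : (0:ℝ) ≤ 1 / 4 - s) (sub_nonneg.2 hab)]
  · -- `w + 8 s = p · a + q` with `p = 2 + 8 s b`, `q = 2 b + 8 s`, `q ± p ≥ 0`
    have hmin : min (8 * s - 4) (-(8 * s)) = -(8 * s) := min_eq_right (by linarith)
    rw [hmin]
    set a := cos x
    set b := cos y
    have hp : |(2 + 8 * s * b) * a| ≤ |2 + 8 * s * b| := by
      rw [abs_mul]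
      exact mul_le_of_le_one_right (abs_nonneg _) (abs_le.2 ⟨ha2, ha1⟩)
    have hq : |2 + 8 * s * b| ≤ 2 * b + 8 * s := by
      rw [abs_le]
      constructor
      · nlinarith [mul_nonneg (by linarith : (0:ℝ) ≤ 1 + b) (by linarith : (0:ℝ) ≤ 2 + 8 * s)]
      · nlinarith [mul_nonneg (by linarith : (0:ℝ) ≤ 1 - b) (by linarith : (0:ℝ) ≤ 8 * s - 2)]
    have := neg_abs_le ((2 + 8 * s * b) * a)
    nlinarith

/-- For every real `s`, the oscillation of `w_s` over the zone is at most `kinBandwidth s`. -/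
theorem kinSymbol_sub_le_kinBandwidth (s x y x' y' : ℝ) :
    kinSymbol s x y - kinSymbol s x' y' ≤ kinBandwidth s := by
  -- first for `s ≥ 0`
  have key : ∀ {s : ℝ}, 0 ≤ s → ∀ x y x' y' : ℝ,
      kinSymbol s x y - kinSymbol s x' y' ≤ kinBandwidth s := by
    intro s hs x y x' y'
    have h1 := kinSymbol_le hs x y
    have h2 := le_kinSymbol s x' y'
    unfold kinBandwidth
    rw [abs_of_nonneg hs]
    rcases le_or_gt s (1 / 4) with h | h
    · rw [min_eq_left (by linarith)] at h2
      calc kinSymbol s x y - kinSymbol s x' y' ≤ 8 := by linarith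
        _ ≤ max 8 (4 + 16 * s) := le_max_left _ _
    · rw [min_eq_right (by linarith)] at h2
      calc kinSymbol s x y - kinSymbol s x' y' ≤ 4 + 16 * s := by linarith
        _ ≤ max 8 (4 + 16 * s) := le_max_right _ _
  rcases le_or_gt 0 s with hs | hs
  · exact key hs x y x' y'
  · -- `s < 0`: `w_s(x, y) = -w_{-s}(π - x, π - y)`
    have e1 : kinSymbol s x y = -kinSymbol (-s) (π - x) (π - y) := by
      rw [kinSymbol_pi_sub, neg_neg, neg_neg]
    have e2 : kinSymbol s x' y' = -kinSymbol (-s) (π - x') (π - y') := by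
      rw [kinSymbol_pi_sub, neg_neg, neg_neg]
    rw [e1, e2, ← kinBandwidth_neg]
    have := key (by linarith : 0 ≤ -s) (π - x') (π - y') (π - x) (π - y)
    linarith

/-- The bandwidth is attained. -/
theorem kinBandwidth_attained (s : ℝ) :
    ∃ x y x' y' : ℝ, kinSymbol s x y - kinSymbol s x' y' = kinBandwidth s := by
  unfold kinBandwidth kinSymbol
  rcases le_or_gt |s| (1 / 4) with h | h
  · -- `w(0,0) - w(π,π) = (4 + 8 s) - (-4 + 8 s) = 8`
    refine ⟨0, 0, π, π, ?_⟩
    rw [max_eq_left (by linarith)]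
    simp only [Real.cos_zero, Real.cos_pi]
    ring
  · rcases le_or_gt 0 s with hs | hs
    · -- `s > 1/4`: `w(0,0) - w(0,π) = (4 + 8 s) - (-8 s)`
      refine ⟨0, 0, 0, π, ?_⟩
      rw [abs_of_nonneg hs] at h ⊢
      rw [max_eq_right (by linarith)]
      simp only [Real.cos_zero, Real.cos_pi]
      ring
    · -- `s < -1/4`: `w(0,π) - w(π,π) = (-8 s) - (-4 + 8 s)`
      refine ⟨0, π, π, π, ?_⟩
      rw [abs_of_neg hs] at h ⊢
      rw [max_eq_right (by linarith)]
      simp only [Real.cos_zero, Real.cos_pi]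
      ring

/-! ### The `L¹` mass: evenness, monotonicity, Lipschitz bound, value at `s = 0` -/

/-- `∫∫ |w_{−s}| = ∫∫ |w_s|`, by the zone shift `k ↦ k + (π, π)` (reflection `y ↦ π − y` in each variable
and `2π`-periodicity). -/
theorem bzInt_abs_kinSymbol_neg (s : ℝ) :
    bzInt (fun x y => |kinSymbol (-s) x y|) = bzInt (fun x y => |kinSymbol s x y|) := by
  unfold bzInt
  set F : ℝ → ℝ := fun y => ∫ x in (-π)..π, |kinSymbol s x y| with hF
  have hFper : Function.Periodic F (2 * π) := by
    intro y
    simp only [hF, kinSymbol, cos_add_two_pi]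
  have hinner : ∀ y : ℝ, ∫ x in (-π)..π, |kinSymbol (-s) x y| = F (π - y) := by
    intro y
    have hper : Function.Periodic (fun x => |kinSymbol s x (π - y)|) (2 * π) := by
      intro x
      simp only [kinSymbol, cos_add_two_pi]
    calc ∫ x in (-π)..π, |kinSymbol (-s) x y|
        = ∫ x in (-π)..π, |kinSymbol s (π - x) (π - y)| := by
          congr 1
          funext x
          exact abs_kinSymbol_neg s x y
      _ = ∫ x in (-π)..π, |kinSymbol s x (π - y)| := integral_comp_pi_sub_of_periodic hper
      _ = F (π - y) := by simp only [hF]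
  simp_rw [hinner]
  exact integral_comp_pi_sub_of_periodic hFper

/-- `kinL1` is even: `|w_{-s}(k)| = |w_s(k + (π, π))|`. -/
theorem kinL1_neg (s : ℝ) : kinL1 (-s) = kinL1 s := by
  unfold kinL1
  rw [bzInt_abs_kinSymbol_neg]

/-- `kinL1` is non-decreasing on `[0, ∞)` (convexity in `s` — the symbol is affine in `s` — and
evenness). -/
theorem kinL1_mono {a b : ℝ} (ha : 0 ≤ a) (hab : a ≤ b) : kinL1 a ≤ kinL1 b := by
  rcases eq_or_lt_of_le (ha.trans hab) with hb | hb
  · have ha0 : a = 0 := le_antisymm (hab.trans hb.symm.le) ha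
    have : kinL1 a = kinL1 b := by rw [ha0, ← hb]
    exact this.le
  have hb0 : b ≠ 0 := ne_of_gt hb
  set l : ℝ := (b - a) / (2 * b) with hl
  have hl0 : 0 ≤ l := div_nonneg (by linarith) (by linarith)
  have hl1 : l ≤ 1 := by
    rw [hl, div_le_one (by linarith)]
    linarith
  have key : ∀ x y : ℝ,
      |kinSymbol a x y| ≤ l * |kinSymbol (-b) x y| + (1 - l) * |kinSymbol b x y| := by
    intro x y
    have hdec : kinSymbol a x y = l * kinSymbol (-b) x y + (1 - l) * kinSymbol b x y := by
      simp only [kinSymbol, hl]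
      field_simp
      ring
    rw [hdec]
    calc |l * kinSymbol (-b) x y + (1 - l) * kinSymbol b x y|
        ≤ |l * kinSymbol (-b) x y| + |(1 - l) * kinSymbol b x y| := abs_add_le _ _
      _ = l * |kinSymbol (-b) x y| + (1 - l) * |kinSymbol b x y| := by
          rw [abs_mul, abs_mul, abs_of_nonneg hl0, abs_of_nonneg (sub_nonneg.2 hl1)]
  have hcont : Continuous fun p : ℝ × ℝ =>
      l * |kinSymbol (-b) p.1 p.2| + (1 - l) * |kinSymbol b p.1 p.2| :=
    (continuous_const_mul_abs_kinSymbol l (-b)).fun_add (continuous_const_mul_abs_kinSymbol (1 - l) b)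
  have hint : bzInt (fun x y => |kinSymbol a x y|) ≤ bzInt (fun x y => |kinSymbol b x y|) := by
    calc bzInt (fun x y => |kinSymbol a x y|)
        ≤ bzInt (fun x y => l * |kinSymbol (-b) x y| + (1 - l) * |kinSymbol b x y|) :=
          bzInt_mono (continuous_abs_kinSymbol a) hcont key
      _ = l * bzInt (fun x y => |kinSymbol (-b) x y|) +
            (1 - l) * bzInt (fun x y => |kinSymbol b x y|) := by
          rw [bzInt_add (continuous_const_mul_abs_kinSymbol l (-b))
            (continuous_const_mul_abs_kinSymbol (1 - l) b), bzInt_const_mul, bzInt_const_mul]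
      _ = bzInt (fun x y => |kinSymbol b x y|) := by
          rw [bzInt_abs_kinSymbol_neg]
          ring
  unfold kinL1
  exact div_le_div_of_nonneg_right hint (by positivity)

/-- Lipschitz bound: `kinL1 s ≤ kinL1 s₀ + (32/π²)|s − s₀|` (`|w_s| ≤ |w_{s₀}| + 8|s − s₀||cos x cos y|`
and `∫∫|cos x cos y| = 16`). -/
theorem kinL1_le_add (s s₀ : ℝ) : kinL1 s ≤ kinL1 s₀ + 32 / π ^ 2 * |s - s₀| := by
  have key : ∀ x y : ℝ,
      |kinSymbol s x y| ≤ |kinSymbol s₀ x y| + 8 * |s - s₀| * |cos x * cos y| := by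
    intro x y
    rw [kinSymbol_affine s s₀ x y]
    calc |kinSymbol s₀ x y + 8 * (s - s₀) * (cos x * cos y)|
        ≤ |kinSymbol s₀ x y| + |8 * (s - s₀) * (cos x * cos y)| := abs_add_le _ _
      _ = |kinSymbol s₀ x y| + 8 * |s - s₀| * |cos x * cos y| := by
          rw [abs_mul, abs_mul]
          norm_num
  have hc : Continuous fun p : ℝ × ℝ => 8 * |s - s₀| * |cos p.1 * cos p.2| := by fun_prop
  have hcont : Continuous fun p : ℝ × ℝ =>
      |kinSymbol s₀ p.1 p.2| + 8 * |s - s₀| * |cos p.1 * cos p.2| :=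
    (continuous_abs_kinSymbol s₀).fun_add hc
  have hint : bzInt (fun x y => |kinSymbol s x y|) ≤
      bzInt (fun x y => |kinSymbol s₀ x y|) + 8 * |s - s₀| * 16 := by
    calc bzInt (fun x y => |kinSymbol s x y|)
        ≤ bzInt (fun x y => |kinSymbol s₀ x y| + 8 * |s - s₀| * |cos x * cos y|) :=
          bzInt_mono (continuous_abs_kinSymbol s) hcont key
      _ = bzInt (fun x y => |kinSymbol s₀ x y|) +
            8 * |s - s₀| * bzInt (fun x y : ℝ => |cos x * cos y|) := by
          rw [bzInt_add (continuous_abs_kinSymbol s₀) hc, bzInt_const_mul]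
      _ = bzInt (fun x y => |kinSymbol s₀ x y|) + 8 * |s - s₀| * 16 := by
          unfold bzInt
          rw [integral_integral_abs_cos_mul_cos]
  unfold kinL1
  have hπ : 0 < π := pi_pos
  rw [div_add' _ _ _ (by positivity), div_le_div_iff_of_pos_right (by positivity)]
  have : 32 / π ^ 2 * |s - s₀| * (2 * π) ^ 2 = 8 * |s - s₀| * 16 := by
    field_simp
    ring
  linarith

/-- `kinL1 0 = 16/π²` (`∫∫ |2(cos x + cos y)| = 64`). -/
theorem kinL1_zero : kinL1 0 = 16 / π ^ 2 := by
  unfold kinL1 bzInt kinSymbol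
  have h : ∀ x y : ℝ, |2 * (cos x + cos y) + 8 * 0 * (cos x * cos y)| = 2 * |cos x + cos y| := by
    intro x y
    rw [mul_zero, zero_mul, add_zero, abs_mul, abs_two]
  simp_rw [h, intervalIntegral.integral_const_mul]
  rw [integral_integral_abs_cos_add_cos]
  have hπ : 0 < π := pi_pos
  field_simp
  ring

/-! ### The extremiser -/

/-- At `s = 1/4` the bandwidth is `8`, so `merit (1/4) = kinL1 (1/4) / 2`. -/
theorem merit_quarter : merit (1 / 4) = kinL1 (1 / 4) / 2 := by
  unfold merit kinBandwidth
  rw [abs_of_pos (by norm_num : (0:ℝ) < 1 / 4), max_eq_left (by norm_num)]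
  ring

/-- `kinL1 |s| = kinL1 s` (evenness). -/
theorem kinL1_abs (s : ℝ) : kinL1 |s| = kinL1 s := by
  rcases le_or_gt 0 s with h | h
  · rw [abs_of_nonneg h]
  · rw [abs_of_neg h, kinL1_neg]

/-- **The bandwidth-normalised one-body ceiling of the `t`–`t′` class is maximal at `|t′| = t/4`.** -/
theorem merit_le (s : ℝ) : merit s ≤ merit (1 / 4) := by
  have hq : kinL1 0 ≤ kinL1 (1 / 4) := kinL1_mono le_rfl (by norm_num)
  have hg0 := kinL1_zero
  rw [merit_quarter]
  unfold merit
  rcases le_or_gt |s| (1 / 4) with h | h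
  · have hW : kinBandwidth s = 8 := by
      unfold kinBandwidth
      exact max_eq_left (by linarith)
    rw [hW, ← kinL1_abs s]
    have hm := kinL1_mono (abs_nonneg s) h
    have : 4 * kinL1 |s| / 8 = kinL1 |s| / 2 := by ring
    rw [this]
    linarith
  · have hW : kinBandwidth s = 4 + 16 * |s| := by
      unfold kinBandwidth
      exact max_eq_right (by linarith)
    rw [hW, ← kinL1_abs s]
    have hL := kinL1_le_add |s| (1 / 4)
    rw [abs_of_nonneg (by linarith : (0:ℝ) ≤ |s| - 1 / 4)] at hL
    have hπ : 0 < π := pi_pos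
    have hslope : 32 / π ^ 2 ≤ 2 * kinL1 (1 / 4) := by
      have : 32 / π ^ 2 = 2 * (16 / π ^ 2) := by ring
      rw [this, ← hg0]
      linarith
    have hprod := mul_le_mul_of_nonneg_right hslope (by linarith : (0:ℝ) ≤ |s| - 1 / 4)
    rw [div_le_div_iff₀ (by positivity) (by norm_num)]
    nlinarith

/-- The maximal value in closed form: `merit (1/4) = kinL1 (1/4) / 2 = (8π²)⁻¹ ∫∫ |2(cos x + cos y) + 2 cos x cos y|`;
and the endpoint values `merit 0 = kinL1 0 / 2 = 8/π²`. -/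
theorem merit_zero : merit 0 = 8 / π ^ 2 := by
  unfold merit kinBandwidth
  rw [kinL1_zero, abs_zero, mul_zero, add_zero, max_eq_left (by norm_num)]
  ring

/-! ### Caveat: normalising by the bandwidth of the dispersion instead -/

/-- Bandwidth (oscillation over the zone) of the DISPERSION `ε_s = -(2(cos k₁ + cos k₂) + 4 s cos k₁ cos k₂)`
(`= -w_{s/2}`), units `t = 1`. -/
def dispBandwidth (s : ℝ) : ℝ := max 8 (4 + 8 * |s|)

/-- The one-body ceiling per unit bandwidth of the DISPERSION (rather than of the kinetic symbol `w_s`). -/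
def meritDisp (s : ℝ) : ℝ := 4 * kinL1 s / dispBandwidth s

/-- The dispersion bandwidth is positive. -/
theorem dispBandwidth_pos (s : ℝ) : 0 < dispBandwidth s :=
  lt_of_lt_of_le (by norm_num) (le_max_left _ _)

/-- For `|s| ≤ 1/2` the dispersion bandwidth is `8` and `meritDisp s = kinL1 s / 2`, non-decreasing in `|s|`
(`kinL1_mono`). -/
theorem meritDisp_eq {s : ℝ} (hs : |s| ≤ 1 / 2) : meritDisp s = kinL1 s / 2 := by
  unfold meritDisp dispBandwidth
  rw [max_eq_left (by linarith)]
  ring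

/-- `meritDisp` is non-decreasing on `[0, 1/2]`. -/
theorem meritDisp_mono {a b : ℝ} (ha : 0 ≤ a) (hab : a ≤ b) (hb : b ≤ 1 / 2) :
    meritDisp a ≤ meritDisp b := by
  rw [meritDisp_eq (by rw [abs_of_nonneg ha]; linarith),
    meritDisp_eq (by rw [abs_of_nonneg (ha.trans hab)]; linarith)]
  linarith [kinL1_mono ha hab]

/-- Under dispersion-bandwidth normalisation there is NO interior extremiser: `meritDisp s ≤ 16/π² = 2 · merit 0`
for every `s`, and `16/π²` is the value approached as `|t′|/t → ∞` (reverse triangle inequality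
`kinL1 s ≥ (32/π²)|s| − 16/π²`; that limit statement is proved in the companion text, not here). -/
theorem meritDisp_le (s : ℝ) : meritDisp s ≤ 16 / π ^ 2 := by
  have hL := kinL1_le_add |s| 0
  rw [kinL1_abs, kinL1_zero, sub_zero, abs_abs] at hL
  have hW : 4 + 8 * |s| ≤ dispBandwidth s := le_max_right _ _
  unfold meritDisp
  rw [div_le_iff₀ (dispBandwidth_pos s)]
  calc 4 * kinL1 s ≤ 4 * (16 / π ^ 2 + 32 / π ^ 2 * |s|) := by linarith
    _ = 16 / π ^ 2 * (4 + 8 * |s|) := by ring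
    _ ≤ 16 / π ^ 2 * dispBandwidth s := mul_le_mul_of_nonneg_left hW (by positivity)

end

end Summit.HubbardSuperconductivity.HubbardLadder.Bounds
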